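import Mathlib
import Literature.Analysis.FluidPDE.KNSSMildDecayHorizontal
import Literature.Analysis.FluidPDE.BiotSavartBounds

/-!
# Crux `SlicedKelvin.PlanarFluxAPriori` (stmt-NavierStokesRegularity-15600), line `registered`,
# stub `stub_decayPersistence` — the Oseen majorant carries the truncated cubic weight

Support file (theorems only) for the decay-persistence stub of the crux `PlanarFluxAPriori`:
the two weighted kernel estimates behind the propagation of the cubic spatial weight
`(1 + |x|)³` along the Oseen (mild) formulation of a bounded classical solution
(Brandolese 2004; Kukavica–Torres 2006: space decay of strong solutions from decaying data,
via the Oseen kernel bound `|K(σ, z)| ≤ C (σ + |z|²)^{-2}`, KNSS 2009 (3.8)).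

* `decay_lintegral_oseenWeight_le` — for the **truncated cubic weights**
  `w_R(y) = (min (1 + |y|) R)³`, `R ≥ 1`, the parabolic majorant satisfies
  `∫ (s + |x - y|²)^{-2} w_R(x) / w_R(y) dy ≤ C_K (s^{-1/2} + 1)` uniformly in `R`, `x`
  (near field `2|y| ≥ |x|`: `w_R(x) ≤ 8 w_R(y)` and `∫ (s + |z|²)^{-2} dz = M s^{-1/2}`; far field
  `2|y| < |x|`: the kernel is `≤ 16 |x|⁻⁴`, the ratio is `≤ 1 + (1+|x|)³ |y|⁻²`, and
  `∫_{|y| < |x|/2} |y|⁻² dy = 2π|x|`).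
* `decay_weighted_heatExtension_le` — the caloric extension keeps the cubic weight:
  `(1 + |x|)³ |e^{sΔ} f (x)| ≤ C_G (1 + s^{3/2}) sup (1 + |y|)³ |f(y)|`.

## References

* L. Brandolese, *Space-time decay of Navier–Stokes flows invariant under rotations*,
  Math. Ann. 329 (2004) = arXiv:math/0403136.
* I. Kukavica, J. J. Torres, *Weighted bounds for the velocity and the vorticity for the
  Navier–Stokes equations*, Nonlinearity 19 (2006).
* G. Koch, N. Nadirashvili, G. Seregin, V. Šverák, Acta Math. 203 (2009), §3 (3.8).
-/

noncomputable section

-- the summit and its single sub-problem share the name (CONVENTIONS §1), as in every Theorems file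
set_option linter.dupNamespace false

namespace Summit.NavierStokesRegularity.NavierStokesRegularity.Theorems.SlicedKelvinPlanarFluxAPriori

open MeasureTheory Set Filter Topology Metric Real
open scoped ENNReal NNReal
open Literature.Analysis.FluidPDE Literature.Analysis.UnboundedOperators

/-! ### The truncated cubic weights `w_R(y) = (min (1 + |y|) R)³` -/

/-- The truncated weight is at least `1` (`R ≥ 1`). -/
theorem decay_one_le_weight {R : ℝ} (hR : 1 ≤ R) (y : EuclideanSpace ℝ (Fin 3)) :
    1 ≤ (min (1 + ‖y‖) R) ^ 3 := by
  have h : 1 ≤ min (1 + ‖y‖) R := le_min (by linarith [norm_nonneg y]) hR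
  exact one_le_pow₀ h

/-- The truncated weight is at most the full cubic weight. -/
theorem decay_weight_le_cube (R : ℝ) (y : EuclideanSpace ℝ (Fin 3)) :
    (min (1 + ‖y‖) R) ^ 3 ≤ (1 + ‖y‖) ^ 3 := by
  have h0 : 0 ≤ 1 + ‖y‖ := by positivity
  rcases le_total (1 + ‖y‖) R with h | h
  · rw [min_eq_left h]
  · rw [min_eq_right h]
    rcases le_or_gt 0 R with hR0 | hR0
    · exact pow_le_pow_left₀ hR0 h 3
    · have : R ^ 3 ≤ 0 := by
        have : R ^ 3 = R * R ^ 2 := by ring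
        rw [this]; exact mul_nonpos_of_nonpos_of_nonneg hR0.le (sq_nonneg R)
      exact this.trans (by positivity)

/-- **Near field**: if `|x| ≤ 2|y|` then `w_R(x) ≤ 8 w_R(y)` (`R ≥ 1`). -/
theorem decay_weight_ratio_le_eight {R : ℝ} (hR : 1 ≤ R) {x y : EuclideanSpace ℝ (Fin 3)}
    (hxy : ‖x‖ ≤ 2 * ‖y‖) : (min (1 + ‖x‖) R) ^ 3 ≤ 8 * (min (1 + ‖y‖) R) ^ 3 := by
  have h1 : min (1 + ‖x‖) R ≤ 2 * min (1 + ‖y‖) R := by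
    rcases le_total (1 + ‖y‖) R with h | h
    · rw [min_eq_left h]
      exact (min_le_left _ _).trans (by linarith)
    · rw [min_eq_right h]
      exact (min_le_right _ _).trans (by linarith)
  have h0 : 0 ≤ min (1 + ‖x‖) R := le_min (by positivity) (by linarith)
  calc (min (1 + ‖x‖) R) ^ 3 ≤ (2 * min (1 + ‖y‖) R) ^ 3 := pow_le_pow_left₀ h0 h1 3
    _ = 8 * (min (1 + ‖y‖) R) ^ 3 := by ring

/-- **Far field**: for `y ≠ 0`, `w_R(x) / w_R(y) ≤ 1 + (1 + |x|)³ |y|⁻²` (`R ≥ 1`). -/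
theorem decay_weight_ratio_le_far {R : ℝ} (hR : 1 ≤ R) (x : EuclideanSpace ℝ (Fin 3))
    {y : EuclideanSpace ℝ (Fin 3)} (hy : y ≠ 0) :
    (min (1 + ‖x‖) R) ^ 3 / (min (1 + ‖y‖) R) ^ 3 ≤ 1 + (1 + ‖x‖) ^ 3 * (‖y‖ ^ 2)⁻¹ := by
  have hy0 : 0 < ‖y‖ := norm_pos_iff.2 hy
  have hwy : 0 < (min (1 + ‖y‖) R) ^ 3 := lt_of_lt_of_le one_pos (decay_one_le_weight hR y)
  have hX0 : 0 ≤ (1 + ‖x‖) ^ 3 * (‖y‖ ^ 2)⁻¹ := by positivity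
  rw [div_le_iff₀ hwy]
  rcases le_total (1 + ‖y‖) R with h | h
  · -- `w_R(y) = (1 + |y|)³`
    rw [min_eq_left h]
    have hx : (min (1 + ‖x‖) R) ^ 3 ≤ (1 + ‖x‖) ^ 3 := decay_weight_le_cube R x
    have h2 : ‖y‖ ^ 2 ≤ (1 + ‖y‖) ^ 3 := by
      have h3 : ‖y‖ ^ 2 ≤ (1 + ‖y‖) ^ 2 := by nlinarith
      have h4 : (1 + ‖y‖) ^ 2 ≤ (1 + ‖y‖) ^ 3 := by
        have : (1 : ℝ) ≤ 1 + ‖y‖ := by linarith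
        nlinarith
      linarith
    have h5 : 1 ≤ (‖y‖ ^ 2)⁻¹ * (1 + ‖y‖) ^ 3 := by
      rw [inv_mul_eq_div, le_div_iff₀ (by positivity)]
      linarith
    have hkey : (1 + ‖x‖) ^ 3 ≤ (1 + ‖x‖) ^ 3 * (‖y‖ ^ 2)⁻¹ * (1 + ‖y‖) ^ 3 := by
      calc (1 + ‖x‖) ^ 3 = (1 + ‖x‖) ^ 3 * 1 := by ring
        _ ≤ (1 + ‖x‖) ^ 3 * ((‖y‖ ^ 2)⁻¹ * (1 + ‖y‖) ^ 3) :=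
            mul_le_mul_of_nonneg_left h5 (by positivity)
        _ = (1 + ‖x‖) ^ 3 * (‖y‖ ^ 2)⁻¹ * (1 + ‖y‖) ^ 3 := by ring
    have hpos : 0 ≤ (1 + ‖y‖) ^ 3 := by positivity
    calc (min (1 + ‖x‖) R) ^ 3 ≤ (1 + ‖x‖) ^ 3 := hx
      _ ≤ (1 + ‖x‖) ^ 3 * (‖y‖ ^ 2)⁻¹ * (1 + ‖y‖) ^ 3 := hkey
      _ ≤ (1 + ‖x‖) ^ 3 * (‖y‖ ^ 2)⁻¹ * (1 + ‖y‖) ^ 3 + (1 + ‖y‖) ^ 3 :=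
          le_add_of_nonneg_right hpos
      _ = (1 + (1 + ‖x‖) ^ 3 * (‖y‖ ^ 2)⁻¹) * (1 + ‖y‖) ^ 3 := by ring
  · -- `w_R(y) = R³ ≥ w_R(x)`
    rw [min_eq_right h]
    have hx : (min (1 + ‖x‖) R) ^ 3 ≤ R ^ 3 :=
      pow_le_pow_left₀ (le_min (by positivity) (by linarith)) (min_le_right _ _) 3
    have hR3 : 0 ≤ R ^ 3 := by positivity
    calc (min (1 + ‖x‖) R) ^ 3 ≤ R ^ 3 := hx
      _ ≤ R ^ 3 + (1 + ‖x‖) ^ 3 * (‖y‖ ^ 2)⁻¹ * R ^ 3 :=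
          le_add_of_nonneg_right (mul_nonneg hX0 hR3)
      _ = (1 + (1 + ‖x‖) ^ 3 * (‖y‖ ^ 2)⁻¹) * R ^ 3 := by ring

/-! ### The weighted Oseen majorant -/

/-- The parabolic majorant on the far field: if `2|y| < |x|` then
`(s + |x - y|²)^{-2} ≤ 16 |x|⁻⁴` (`s > 0`). -/
theorem decay_majorant_far_le {s : ℝ} (hs : 0 < s) {x y : EuclideanSpace ℝ (Fin 3)}
    (hxy : 2 * ‖y‖ < ‖x‖) : (s + ‖x - y‖ ^ 2) ^ (-(2 : ℝ)) ≤ 16 * (‖x‖ ^ 4)⁻¹ := by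
  have hx0 : 0 < ‖x‖ := lt_of_le_of_lt (by positivity) hxy
  have h2 : ‖x‖ - ‖y‖ ≤ ‖x - y‖ := norm_sub_norm_le x y
  have h1 : ‖x‖ / 2 ≤ ‖x - y‖ := by linarith
  have h3 : (‖x‖ / 2) ^ 2 ≤ s + ‖x - y‖ ^ 2 := by
    have : (‖x‖ / 2) ^ 2 ≤ ‖x - y‖ ^ 2 := pow_le_pow_left₀ (by positivity) h1 2
    linarith
  have h4 : 0 < (‖x‖ / 2) ^ 2 := by positivity
  calc (s + ‖x - y‖ ^ 2) ^ (-(2 : ℝ)) ≤ ((‖x‖ / 2) ^ 2) ^ (-(2 : ℝ)) :=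
        Real.rpow_le_rpow_of_nonpos h4 h3 (by norm_num)
    _ = 16 * (‖x‖ ^ 4)⁻¹ := by
        rw [Real.rpow_neg h4.le, show (2 : ℝ) = ((2 : ℕ) : ℝ) by norm_num, Real.rpow_natCast]
        field_simp
        ring

/-- **The truncated cubic weight is carried by the Oseen majorant**: there is an absolute
`C_K > 0` with `∫ (s + |x - y|²)^{-2} w_R(x)/w_R(y) dy ≤ C_K (s^{-1/2} + 1)` for all `R ≥ 1`,
`s > 0`, `x ∈ ℝ³`, where `w_R(y) = (min (1 + |y|) R)³` (the near/far-field computation of the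
module docstring; Brandolese 2004, Kukavica–Torres 2006 for the untruncated weight). -/
theorem decay_lintegral_oseenWeight_le :
    ∃ C_K : ℝ, 0 < C_K ∧ ∀ ⦃R : ℝ⦄, 1 ≤ R → ∀ ⦃s : ℝ⦄, 0 < s → ∀ x : EuclideanSpace ℝ (Fin 3),
      ∫⁻ y, ENNReal.ofReal ((s + ‖x - y‖ ^ 2) ^ (-(2 : ℝ)) *
          ((min (1 + ‖x‖) R) ^ 3 / (min (1 + ‖y‖) R) ^ 3)) ≤
        ENNReal.ofReal (C_K * (s ^ (-(1 / 2 : ℝ)) + 1)) := by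
  have hfin : (Module.finrank ℝ (EuclideanSpace ℝ (Fin 3)) : ℝ) = 3 := by
    rw [finrank_euclideanSpace_fin]; norm_num
  have he : (Module.finrank ℝ (EuclideanSpace ℝ (Fin 3)) : ℝ) < 2 * 2 := by rw [hfin]; norm_num
  set M₃ : ℝ := ∫ w : EuclideanSpace ℝ (Fin 3), (1 + ‖w‖ ^ 2) ^ (-(2 : ℝ)) with hM₃
  have hM₃0 : 0 < M₃ := integral_one_add_norm_sq_rpow_neg_pos he
  -- the scaled majorant integral
  have hmaj : ∀ {s : ℝ}, 0 < s → ∀ x : EuclideanSpace ℝ (Fin 3),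
      ∫⁻ y, ENNReal.ofReal ((s + ‖x - y‖ ^ 2) ^ (-(2 : ℝ))) =
        ENNReal.ofReal (s ^ (-(1 / 2 : ℝ)) * M₃) := by
    intro s hs x
    have hsub := lintegral_sub_left_eq_self (μ := (volume : Measure (EuclideanSpace ℝ (Fin 3))))
      (fun z : EuclideanSpace ℝ (Fin 3) => ENNReal.ofReal ((s + ‖z‖ ^ 2) ^ (-(2 : ℝ)))) x
    rw [hsub, lintegral_add_norm_sq_rpow_neg he hs, ← hM₃, hfin,
      show ((3 : ℝ) / 2 - 2) = -(1 / 2 : ℝ) by norm_num]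
  refine ⟨8 * M₃ + 270 * π, by positivity, fun R hR s hs x => ?_⟩
  clear_value M₃
  have hs12 : 0 < s ^ (-(1 / 2 : ℝ)) := Real.rpow_pos_of_pos hs _
  have hp1 : 0 ≤ M₃ * s ^ (-(1 / 2 : ℝ)) := by positivity
  have hp2 : 0 ≤ π * s ^ (-(1 / 2 : ℝ)) := by positivity
  rcases lt_or_ge ‖x‖ 1 with hx1 | hx1
  · -- `|x| < 1`: the ratio is at most `8` everywhere
    have hpt : ∀ y, ENNReal.ofReal ((s + ‖x - y‖ ^ 2) ^ (-(2 : ℝ)) *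
        ((min (1 + ‖x‖) R) ^ 3 / (min (1 + ‖y‖) R) ^ 3)) ≤
        ENNReal.ofReal 8 * ENNReal.ofReal ((s + ‖x - y‖ ^ 2) ^ (-(2 : ℝ))) := by
      intro y
      rw [← ENNReal.ofReal_mul (p := 8) (by norm_num), mul_comm (8 : ℝ)]
      refine ENNReal.ofReal_le_ofReal (mul_le_mul_of_nonneg_left ?_ (Real.rpow_nonneg (by positivity) _))
      rw [div_le_iff₀ (lt_of_lt_of_le one_pos (decay_one_le_weight hR y))]
      have h1 : (min (1 + ‖x‖) R) ^ 3 ≤ (1 + ‖x‖) ^ 3 := decay_weight_le_cube R x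
      have h2 : (1 + ‖x‖) ^ 3 ≤ 8 := by
        calc (1 + ‖x‖) ^ 3 ≤ 2 ^ 3 := pow_le_pow_left₀ (by positivity) (by linarith) 3
          _ = 8 := by norm_num
      have h3 := decay_one_le_weight hR y
      nlinarith
    calc ∫⁻ y, ENNReal.ofReal ((s + ‖x - y‖ ^ 2) ^ (-(2 : ℝ)) *
          ((min (1 + ‖x‖) R) ^ 3 / (min (1 + ‖y‖) R) ^ 3))
        ≤ ∫⁻ y, ENNReal.ofReal 8 * ENNReal.ofReal ((s + ‖x - y‖ ^ 2) ^ (-(2 : ℝ))) :=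
          lintegral_mono hpt
      _ = ENNReal.ofReal 8 * ENNReal.ofReal (s ^ (-(1 / 2 : ℝ)) * M₃) := by
          rw [lintegral_const_mul' _ _ ENNReal.ofReal_ne_top, hmaj hs x]
      _ = ENNReal.ofReal (8 * (s ^ (-(1 / 2 : ℝ)) * M₃)) := by
          rw [← ENNReal.ofReal_mul (p := 8) (by norm_num)]
      _ ≤ ENNReal.ofReal ((8 * M₃ + 270 * π) * (s ^ (-(1 / 2 : ℝ)) + 1)) := by
          refine ENNReal.ofReal_le_ofReal ?_
          have hπ := Real.pi_pos
          linarith [hM₃0.le, hp1, hp2]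
  · -- `|x| ≥ 1`: near field / far field
    have hx0 : 0 < ‖x‖ := lt_of_lt_of_le one_pos hx1
    set ρ : ℝ := ‖x‖ / 2 with hρ
    clear_value ρ
    have hρ0 : 0 < ρ := by rw [hρ]; positivity
    set c₂ : ℝ := 16 * (‖x‖ ^ 4)⁻¹ with hc₂
    clear_value c₂
    have hc₂0 : 0 ≤ c₂ := by rw [hc₂]; positivity
    -- the three majorants
    set f₁ : EuclideanSpace ℝ (Fin 3) → ℝ≥0∞ := fun y =>
      ENNReal.ofReal 8 * ENNReal.ofReal ((s + ‖x - y‖ ^ 2) ^ (-(2 : ℝ))) with hf₁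
    clear_value f₁
    set f₂ : EuclideanSpace ℝ (Fin 3) → ℝ≥0∞ := fun y =>
      (ball (0 : EuclideanSpace ℝ (Fin 3)) ρ).indicator (fun _ => ENNReal.ofReal c₂) y with hf₂
    clear_value f₂
    set f₃ : EuclideanSpace ℝ (Fin 3) → ℝ≥0∞ := fun y =>
      ENNReal.ofReal (c₂ * (1 + ‖x‖) ^ 3) * ENNReal.ofReal (kernelMajorant ρ y) with hf₃
    clear_value f₃
    have hmeas : Measurable fun y : EuclideanSpace ℝ (Fin 3) => (s + ‖x - y‖ ^ 2) ^ (-(2 : ℝ)) := by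
      refine Measurable.pow_const ?_ _
      exact measurable_const.add ((measurable_const.sub measurable_id).norm.pow_const 2)
    have hf₁m : Measurable f₁ := by rw [hf₁]; exact (hmeas.ennreal_ofReal).const_mul _
    have hf₂m : Measurable f₂ := by rw [hf₂]; exact measurable_const.indicator measurableSet_ball
    have hf₁₂m : Measurable fun y => f₁ y + f₂ y := hf₁m.add hf₂m
    -- pointwise domination off the origin
    have hpt : ∀ y, y ≠ 0 → ENNReal.ofReal ((s + ‖x - y‖ ^ 2) ^ (-(2 : ℝ)) *
        ((min (1 + ‖x‖) R) ^ 3 / (min (1 + ‖y‖) R) ^ 3)) ≤ f₁ y + f₂ y + f₃ y := by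
      intro y hy
      have hk0 : 0 ≤ (s + ‖x - y‖ ^ 2) ^ (-(2 : ℝ)) := Real.rpow_nonneg (by positivity) _
      have hwy : 0 < (min (1 + ‖y‖) R) ^ 3 := lt_of_lt_of_le one_pos (decay_one_le_weight hR y)
      rcases le_or_gt ‖x‖ (2 * ‖y‖) with hnear | hfar
      · -- near field
        have hratio : (min (1 + ‖x‖) R) ^ 3 / (min (1 + ‖y‖) R) ^ 3 ≤ 8 := by
          rw [div_le_iff₀ hwy]; exact decay_weight_ratio_le_eight hR hnear
        have h1 : ENNReal.ofReal ((s + ‖x - y‖ ^ 2) ^ (-(2 : ℝ)) *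
            ((min (1 + ‖x‖) R) ^ 3 / (min (1 + ‖y‖) R) ^ 3)) ≤ f₁ y := by
          rw [hf₁]; dsimp only
          rw [← ENNReal.ofReal_mul (p := 8) (by norm_num), mul_comm (8 : ℝ)]
          exact ENNReal.ofReal_le_ofReal (mul_le_mul_of_nonneg_left hratio hk0)
        calc ENNReal.ofReal ((s + ‖x - y‖ ^ 2) ^ (-(2 : ℝ)) *
              ((min (1 + ‖x‖) R) ^ 3 / (min (1 + ‖y‖) R) ^ 3)) ≤ f₁ y := h1
          _ ≤ f₁ y + f₂ y + f₃ y := by rw [add_assoc]; exact le_self_add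
      · -- far field
        have hyB : y ∈ ball (0 : EuclideanSpace ℝ (Fin 3)) ρ := by
          rw [mem_ball, dist_zero_right, hρ]; linarith
        have hker : (s + ‖x - y‖ ^ 2) ^ (-(2 : ℝ)) ≤ c₂ := by
          rw [hc₂]; exact decay_majorant_far_le hs hfar
        have hratio := decay_weight_ratio_le_far hR x hy
        have hKM : kernelMajorant ρ y = (‖y‖ ^ 2)⁻¹ := by
          simp only [kernelMajorant, indicator_of_mem hyB]
        have hr0 : 0 ≤ (min (1 + ‖x‖) R) ^ 3 / (min (1 + ‖y‖) R) ^ 3 :=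
          div_nonneg (le_trans zero_le_one (decay_one_le_weight hR x)) hwy.le
        have h1 : ENNReal.ofReal ((s + ‖x - y‖ ^ 2) ^ (-(2 : ℝ)) *
            ((min (1 + ‖x‖) R) ^ 3 / (min (1 + ‖y‖) R) ^ 3)) ≤ f₂ y + f₃ y := by
          have hX : 0 ≤ c₂ * (1 + ‖x‖) ^ 3 := by positivity
          have hY : 0 ≤ c₂ * (1 + ‖x‖) ^ 3 * (‖y‖ ^ 2)⁻¹ := by positivity
          rw [hf₂, hf₃]; dsimp only
          rw [indicator_of_mem hyB, hKM, ← ENNReal.ofReal_mul hX, ← ENNReal.ofReal_add hc₂0 hY]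
          refine ENNReal.ofReal_le_ofReal ?_
          calc (s + ‖x - y‖ ^ 2) ^ (-(2 : ℝ)) * ((min (1 + ‖x‖) R) ^ 3 / (min (1 + ‖y‖) R) ^ 3)
              ≤ c₂ * (1 + (1 + ‖x‖) ^ 3 * (‖y‖ ^ 2)⁻¹) := mul_le_mul hker hratio hr0 hc₂0
            _ = c₂ + c₂ * (1 + ‖x‖) ^ 3 * (‖y‖ ^ 2)⁻¹ := by ring
        calc ENNReal.ofReal ((s + ‖x - y‖ ^ 2) ^ (-(2 : ℝ)) *
              ((min (1 + ‖x‖) R) ^ 3 / (min (1 + ‖y‖) R) ^ 3)) ≤ f₂ y + f₃ y := h1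
          _ ≤ f₁ y + f₂ y + f₃ y := by rw [add_assoc]; exact le_add_self
    have hae : ∀ᵐ y ∂(volume : Measure (EuclideanSpace ℝ (Fin 3))),
        ENNReal.ofReal ((s + ‖x - y‖ ^ 2) ^ (-(2 : ℝ)) *
          ((min (1 + ‖x‖) R) ^ 3 / (min (1 + ‖y‖) R) ^ 3)) ≤ f₁ y + f₂ y + f₃ y := by
      have h0 : ∀ᵐ y ∂(volume : Measure (EuclideanSpace ℝ (Fin 3))),
          y ∉ ({0} : Set (EuclideanSpace ℝ (Fin 3))) :=
        measure_eq_zero_iff_ae_notMem.1 (measure_singleton 0)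
      filter_upwards [h0] with y hy using hpt y (by simpa using hy)
    -- the three integrals
    have hI₁ : ∫⁻ y, f₁ y = ENNReal.ofReal (8 * (s ^ (-(1 / 2 : ℝ)) * M₃)) := by
      rw [hf₁]; dsimp only
      rw [lintegral_const_mul' _ _ ENNReal.ofReal_ne_top, hmaj hs x,
        ← ENNReal.ofReal_mul (p := 8) (by norm_num)]
    have hρ3 : 0 ≤ ρ ^ 3 := by positivity
    have hI₂ : ∫⁻ y, f₂ y = ENNReal.ofReal (c₂ * (ρ ^ 3 * (π * 4 / 3))) := by
      rw [hf₂]; dsimp only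
      rw [lintegral_indicator measurableSet_ball, setLIntegral_const,
        EuclideanSpace.volume_ball_fin_three, ← ENNReal.ofReal_pow hρ0.le,
        ← ENNReal.ofReal_mul hρ3, ← ENNReal.ofReal_mul hc₂0]
    have hX : 0 ≤ c₂ * (1 + ‖x‖) ^ 3 := by positivity
    have hI₃ : ∫⁻ y, f₃ y = ENNReal.ofReal (c₂ * (1 + ‖x‖) ^ 3 * (4 * π * ρ)) := by
      rw [hf₃]; dsimp only
      rw [lintegral_const_mul' _ _ ENNReal.ofReal_ne_top, lintegral_kernelMajorant hρ0.le,
        ← ENNReal.ofReal_mul hX]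
    -- the far-field constants are bounded for `|x| ≥ 1`
    have hxinv : ‖x‖⁻¹ ≤ 1 := inv_le_one_of_one_le₀ hx1
    have hfar₂ : c₂ * (ρ ^ 3 * (π * 4 / 3)) ≤ 8 * π / 3 := by
      have h1 : c₂ * (ρ ^ 3 * (π * 4 / 3)) = (8 * π / 3) * ‖x‖⁻¹ := by
        rw [hc₂, hρ]
        field_simp
        ring
      rw [h1]
      calc (8 * π / 3) * ‖x‖⁻¹ ≤ (8 * π / 3) * 1 := mul_le_mul_of_nonneg_left hxinv (by positivity)
        _ = 8 * π / 3 := mul_one _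
    have hfar₃ : c₂ * (1 + ‖x‖) ^ 3 * (4 * π * ρ) ≤ 256 * π := by
      have h1 : c₂ * (1 + ‖x‖) ^ 3 * (4 * π * ρ) = 32 * π * ((1 + ‖x‖) / ‖x‖) ^ 3 := by
        rw [hc₂, hρ]
        field_simp
        ring
      rw [h1]
      have h2 : (1 + ‖x‖) / ‖x‖ ≤ 2 := by
        rw [div_le_iff₀ hx0]; linarith
      have h3 : ((1 + ‖x‖) / ‖x‖) ^ 3 ≤ 2 ^ 3 := pow_le_pow_left₀ (by positivity) h2 3
      have hπ := Real.pi_pos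
      nlinarith
    have hT₁ : 0 ≤ 8 * (s ^ (-(1 / 2 : ℝ)) * M₃) := by positivity
    have hT₂ : 0 ≤ c₂ * (ρ ^ 3 * (π * 4 / 3)) := by positivity
    have hT₃ : 0 ≤ c₂ * (1 + ‖x‖) ^ 3 * (4 * π * ρ) := by positivity
    have hsum : ENNReal.ofReal (8 * (s ^ (-(1 / 2 : ℝ)) * M₃)) +
          ENNReal.ofReal (c₂ * (ρ ^ 3 * (π * 4 / 3))) +
          ENNReal.ofReal (c₂ * (1 + ‖x‖) ^ 3 * (4 * π * ρ)) =
        ENNReal.ofReal (8 * (s ^ (-(1 / 2 : ℝ)) * M₃) + c₂ * (ρ ^ 3 * (π * 4 / 3)) +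
          c₂ * (1 + ‖x‖) ^ 3 * (4 * π * ρ)) := by
      rw [ENNReal.ofReal_add (add_nonneg hT₁ hT₂) hT₃, ENNReal.ofReal_add hT₁ hT₂]
    calc ∫⁻ y, ENNReal.ofReal ((s + ‖x - y‖ ^ 2) ^ (-(2 : ℝ)) *
          ((min (1 + ‖x‖) R) ^ 3 / (min (1 + ‖y‖) R) ^ 3))
        ≤ ∫⁻ y, (f₁ y + f₂ y + f₃ y) := lintegral_mono_ae hae
      _ = (∫⁻ y, f₁ y) + (∫⁻ y, f₂ y) + ∫⁻ y, f₃ y := by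
          rw [lintegral_add_left hf₁₂m, lintegral_add_left hf₁m]
      _ = ENNReal.ofReal (8 * (s ^ (-(1 / 2 : ℝ)) * M₃) + c₂ * (ρ ^ 3 * (π * 4 / 3)) +
            c₂ * (1 + ‖x‖) ^ 3 * (4 * π * ρ)) := by rw [hI₁, hI₂, hI₃, hsum]
      _ ≤ ENNReal.ofReal ((8 * M₃ + 270 * π) * (s ^ (-(1 / 2 : ℝ)) + 1)) := by
          refine ENNReal.ofReal_le_ofReal ?_
          have hπ := Real.pi_pos
          linarith [hfar₂, hfar₃, hM₃0.le, hp1, hp2]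

end Summit.NavierStokesRegularity.NavierStokesRegularity.Theorems.SlicedKelvinPlanarFluxAPriori

end
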